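import Summits.Ventures.YMGap.RobustBall.PairActivity
import Summits.Ventures.YMGap.RobustBall.PlaquetteCode
import HarnessLib

/-!
# RobustBall/ParallelPairCode — plaquette words, the polymer of a parallel plaquette pair, and triple counts
(cell `pub-ymgap`, track Y2 ROBUST-BALL, T0.2 witness (w3); p1)

HONEST FRAMING: finite-torus combinatorics only (no probability, no continuum, no Clay claim).

* (the plaquette word `plaqWord x i j` — `wordProd = plaquetteHolonomy`, closed walk, balance, the symmetry
  `Re tr U_{(x;j,i)} = Re tr U_{(x;i,j)}`, multiplicities — lives in `RobustBall/PlaquetteCode`, ds-4, shared);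
* `pairCode x i j k = {x, x+e_i, x+e_j, x+e_k, x+e_k+e_i, x+e_k+e_j}` — the base points of the eight links of the
  parallel pair `(x; i, j)`, `(x + e_k; i, j)`; it sits in the unit cube at `x` (`k ≠ i, j`), hence has periodic
  sup-diameter `≤ 1` and vertical window `2` in every direction (read off the CODE — no injectivity needed);
* counts over ORDERED distinct direction triples `OTrip d`: `Σ_t 1 = d(d−1)(d−2)`,
  `Σ_t [t.i = c] = Σ_t [t.j = c] = (d−1)(d−2)`; at most six base points put a site into a pair code;
  `Σ_x mult_{plaqWord x i j}(e) = 2[i = e.2] + 2[j = e.2]`.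
-/

noncomputable section

open MeasureTheory Finset Function
open Literature.Probability.LatticeModels Literature.Probability.LatticeModels.DobrushinMetric
open Literature.MathematicalPhysics.QuantumLattice hiding torusNorm
open Literature.MathematicalPhysics.QuantumFieldTheory hiding ZdEdge

namespace Summit.Ventures.YMGap.RobustBall

variable {d L N : ℕ}

/-! ### The polymer of a parallel pair -/

/-- The polymer of the parallel pair `(x; i, j)`, `(x + e_k; i, j)`: the base points of its eight links. [folklore] -/
def pairCode (x : Site d L) (i j k : Fin d) : Finset (Site d L) :=
  {x, x + unitVec i, x + unitVec j, x + unitVec k, x + unitVec k + unitVec i, x + unitVec k + unitVec j}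

/-- Every letter of the two plaquette words is based in the pair code. [folklore] -/
theorem site_mem_pairCode {x : Site d L} {i j k : Fin d} {l : Letter d L}
    (hl : l ∈ plaqWord x i j ++ plaqWord (x + unitVec k) i j) : l.site ∈ pairCode x i j k := by
  simp only [plaqWord, List.cons_append, List.nil_append, List.mem_cons, List.mem_nil_iff, or_false] at hl
  rcases hl with rfl | rfl | rfl | rfl | rfl | rfl | rfl | rfl <;> simp [pairCode]

/-- The pair code sits in the unit cube at `x`: every coordinate of every code point is `x v` or `x v + 1`
(`k ≠ i`, `k ≠ j`). [folklore] -/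
theorem apply_mem_pairCode {x : Site d L} {i j k : Fin d} (hki : k ≠ i) (hkj : k ≠ j) {p : Site d L}
    (hp : p ∈ pairCode x i j k) (v : Fin d) : p v = x v ∨ p v = x v + 1 := by
  simp only [pairCode, mem_insert, mem_singleton] at hp
  rcases hp with rfl | rfl | rfl | rfl | rfl | rfl
  · exact Or.inl rfl
  · by_cases h : v = i
    · subst h; right; simp
    · left; simp [unitVec_apply_of_ne h]
  · by_cases h : v = j
    · subst h; right; simp
    · left; simp [unitVec_apply_of_ne h]
  · by_cases h : v = k
    · subst h; right; simp
    · left; simp [unitVec_apply_of_ne h]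
  · by_cases h : v = k
    · subst h; right; simp [unitVec_apply_of_ne hki]
    · by_cases h' : v = i
      · subst h'; right; simp [unitVec_apply_of_ne h]
      · left; simp [unitVec_apply_of_ne h, unitVec_apply_of_ne h']
  · by_cases h : v = k
    · subst h; right; simp [unitVec_apply_of_ne hkj]
    · by_cases h' : v = j
      · subst h'; right; simp [unitVec_apply_of_ne h]
      · left; simp [unitVec_apply_of_ne h, unitVec_apply_of_ne h']

/-- Two points of a unit cube are at periodic sup-distance `≤ 1`. [folklore] -/
theorem torusNorm_sub_le_one_of_cube {x p q : Site d L} (hp : ∀ v, p v = x v ∨ p v = x v + 1)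
    (hq : ∀ v, q v = x v ∨ q v = x v + 1) : torusNorm (p - q) ≤ 1 := by
  refine Finset.sup_le fun v _ => ?_
  have h1 : ((1 : ZMod L).valMinAbs).natAbs ≤ 1 := natAbs_valMinAbs_one_le_one
  have hn : ((-1 : ZMod L).valMinAbs).natAbs ≤ 1 := by
    rw [ZMod.natAbs_valMinAbs_neg]; exact natAbs_valMinAbs_one_le_one
  show ((p - q) v).valMinAbs.natAbs ≤ 1
  rw [Pi.sub_apply]
  rcases hp v with h | h <;> rcases hq v with h' | h' <;> rw [h, h']
  · simp
  · simpa using hn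
  · simpa using h1
  · simp

/-- The pair code has periodic sup-diameter `≤ 2` (indeed `≤ 1`; `k ≠ i, j`). [folklore] -/
theorem polymerDiam_pairCode_le {x : Site d L} {i j k : Fin d} (hki : k ≠ i) (hkj : k ≠ j) :
    polymerDiam (pairCode x i j k) ≤ 2 :=
  Finset.sup_le fun _ hp => Finset.sup_le fun _ hq =>
    (torusNorm_sub_le_one_of_cube (apply_mem_pairCode hki hkj hp) (apply_mem_pairCode hki hkj hq)).trans one_le_two

/-- Vertical window `2` from the code: every code point has `v`-height `x v` or `x v + 1`. [folklore] -/
theorem window_pairCode {x : Site d L} {i j k : Fin d} (hki : k ≠ i) (hkj : k ≠ j) (v : Fin d) :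
    ∃ t₀ : ZMod L, ∀ p ∈ pairCode x i j k, ∃ m : ℕ, m < 2 ∧ p v = t₀ + m := by
  refine ⟨x v, fun p hp => ?_⟩
  rcases apply_mem_pairCode hki hkj hp v with h | h
  · exact ⟨0, by norm_num, by simp [h]⟩
  · exact ⟨1, by norm_num, by simp [h]⟩

/-- At most six base points `x` put a given site into the pair code `pairCode x i j k`. [folklore] -/
theorem card_filter_mem_pairCode_le [NeZero L] (y : Site d L) (i j k : Fin d) :
    (univ.filter fun x : Site d L => y ∈ pairCode x i j k).card ≤ 6 := by
  have hsub : (univ.filter fun x : Site d L => y ∈ pairCode x i j k) ⊆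
      {y, y - unitVec i, y - unitVec j, y - unitVec k, y - unitVec k - unitVec i, y - unitVec k - unitVec j} := by
    intro x hx
    simp only [mem_filter, mem_univ, true_and, pairCode, mem_insert, mem_singleton] at hx
    simp only [mem_insert, mem_singleton]
    rcases hx with rfl | rfl | rfl | rfl | rfl | rfl
    · exact Or.inl rfl
    · exact Or.inr (Or.inl (by abel))
    · exact Or.inr (Or.inr (Or.inl (by abel)))
    · exact Or.inr (Or.inr (Or.inr (Or.inl (by abel))))
    · exact Or.inr (Or.inr (Or.inr (Or.inr (Or.inl (by abel)))))
    · exact Or.inr (Or.inr (Or.inr (Or.inr (Or.inr (by abel)))))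
  refine (card_le_card hsub).trans ?_
  refine (card_insert_le _ _).trans (Nat.succ_le_succ ((card_insert_le _ _).trans (Nat.succ_le_succ
    ((card_insert_le _ _).trans (Nat.succ_le_succ ((card_insert_le _ _).trans (Nat.succ_le_succ
    ((card_insert_le _ _).trans (Nat.succ_le_succ ?_)))))))))
  simp

/-! ### Ordered distinct direction triples and their counts -/

/-- Ordered triples of pairwise distinct directions `(i, j, k)`. [folklore] -/
abbrev OTrip (d : ℕ) : Type := {t : Fin d × Fin d × Fin d // t.1 ≠ t.2.1 ∧ t.2.2 ≠ t.1 ∧ t.2.2 ≠ t.2.1}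

/-- `#{k : k ≠ i ∧ k ≠ j} = d − 2` for `i ≠ j`. [folklore] -/
theorem card_ne_ne {i j : Fin d} (hij : i ≠ j) : (univ.filter fun k : Fin d => k ≠ i ∧ k ≠ j).card = d - 2 := by
  have : (univ.filter fun k : Fin d => k ≠ i ∧ k ≠ j) = (univ.erase i).erase j := by
    ext k; simp [and_comm]
  rw [this, card_erase_of_mem (mem_erase.2 ⟨hij.symm, mem_univ _⟩), card_erase_of_mem (mem_univ _), card_univ,
    Fintype.card_fin]
  omega

/-- Sums over `OTrip d` as iterated sums with an indicator. [folklore] -/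
theorem sum_otrip_eq {M : Type*} [AddCommMonoid M] (g : Fin d → Fin d → Fin d → M) :
    ∑ t : OTrip d, g t.1.1 t.1.2.1 t.1.2.2 =
      ∑ i, ∑ j, ∑ k, if i ≠ j ∧ k ≠ i ∧ k ≠ j then g i j k else 0 := by
  rw [← Finset.sum_subtype (univ.filter fun t : Fin d × Fin d × Fin d => t.1 ≠ t.2.1 ∧ t.2.2 ≠ t.1 ∧ t.2.2 ≠ t.2.1)
    (p := fun t : Fin d × Fin d × Fin d => t.1 ≠ t.2.1 ∧ t.2.2 ≠ t.1 ∧ t.2.2 ≠ t.2.1) (fun t => by simp)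
    (fun t => g t.1 t.2.1 t.2.2)]
  rw [sum_filter, Fintype.sum_prod_type]
  refine sum_congr rfl fun i _ => ?_
  rw [Fintype.sum_prod_type]

/-- Inner count: `Σ_k [i ≠ j ∧ k ≠ i ∧ k ≠ j] = [i ≠ j]·(d − 2)`. [folklore] -/
theorem sum_ite_otrip_inner (i j : Fin d) :
    ∑ k : Fin d, (if (i ≠ j ∧ k ≠ i ∧ k ≠ j) then (1 : ℕ) else 0) = if i ≠ j then d - 2 else 0 := by
  by_cases hij : i ≠ j
  · rw [if_pos hij]
    have : ∀ k : Fin d, (i ≠ j ∧ k ≠ i ∧ k ≠ j) ↔ (k ≠ i ∧ k ≠ j) := fun k => by simp [hij]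
    simp_rw [this]
    rw [sum_boole, card_ne_ne hij]
    simp
  · rw [if_neg hij]
    simp [hij]

/-- `#OTrip d = d(d−1)(d−2)`, as a sum. [folklore] -/
theorem sum_otrip_one : ∑ _t : OTrip d, (1 : ℕ) = d * (d - 1) * (d - 2) := by
  rw [sum_otrip_eq (fun _ _ _ => (1 : ℕ))]
  simp_rw [sum_ite_otrip_inner]
  have : ∀ i : Fin d, ∑ j : Fin d, (if i ≠ j then d - 2 else 0) = (d - 1) * (d - 2) := by
    intro i
    rw [← sum_filter, filter_ne, sum_const, card_erase_of_mem (mem_univ i), card_univ, Fintype.card_fin,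
      smul_eq_mul]
  simp_rw [this]
  rw [sum_const, card_univ, Fintype.card_fin, smul_eq_mul]
  ring

/-- `Σ_{(i,j,k)} [i = c] = (d−1)(d−2)`. [folklore] -/
theorem sum_otrip_ite_fst (c : Fin d) : ∑ t : OTrip d, (if t.1.1 = c then (1 : ℕ) else 0) = (d - 1) * (d - 2) := by
  rw [sum_otrip_eq (fun i _ _ => if i = c then (1 : ℕ) else 0)]
  have h1 : ∀ i j k : Fin d, (if (i ≠ j ∧ k ≠ i ∧ k ≠ j) then (if i = c then (1 : ℕ) else 0) else 0) =
      if i = c then (if (c ≠ j ∧ k ≠ c ∧ k ≠ j) then 1 else 0) else 0 := by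
    intro i j k
    by_cases h : i = c
    · subst h; simp
    · simp [h]
  simp_rw [h1, Finset.sum_ite_irrel, Finset.sum_const_zero]
  rw [sum_ite_eq' univ c]
  simp only [mem_univ, if_true]
  simp_rw [sum_ite_otrip_inner]
  rw [← sum_filter, filter_ne, sum_const, card_erase_of_mem (mem_univ c), card_univ, Fintype.card_fin, smul_eq_mul]

/-- `Σ_{(i,j,k)} [j = c] = (d−1)(d−2)`. [folklore] -/
theorem sum_otrip_ite_snd (c : Fin d) : ∑ t : OTrip d, (if t.1.2.1 = c then (1 : ℕ) else 0) = (d - 1) * (d - 2) := by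
  rw [sum_otrip_eq (fun _ j _ => if j = c then (1 : ℕ) else 0), sum_comm]
  have h1 : ∀ j i k : Fin d, (if (i ≠ j ∧ k ≠ i ∧ k ≠ j) then (if j = c then (1 : ℕ) else 0) else 0) =
      if j = c then (if (i ≠ c ∧ k ≠ i ∧ k ≠ c) then 1 else 0) else 0 := by
    intro j i k
    by_cases h : j = c
    · subst h; simp
    · simp [h]
  simp_rw [h1, Finset.sum_ite_irrel, Finset.sum_const_zero]
  rw [sum_ite_eq' univ c]
  simp only [mem_univ, if_true]
  simp_rw [sum_ite_otrip_inner]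
  rw [← sum_filter, filter_ne', sum_const, card_erase_of_mem (mem_univ c), card_univ, Fintype.card_fin, smul_eq_mul]

end Summit.Ventures.YMGap.RobustBall

end
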